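import Literature.MathematicalPhysics.QuantumManyBody.PeriodicMaxFormPositivity
import Mathlib.MeasureTheory.Function.ConvergenceInMeasure
import HarnessLib

/-!
# The weighted increment comparison principle on the torus: increments at one-coordinate shifts

Topic `Literature/MathematicalPhysics/QuantumManyBody`, sequel of the section `Comparison` of
`PeriodicMaxFormPositivity.lean` (support file; everything proved; no definitions, no named facts; the
measure on `ℝ/ℤ` is the Haar probability measure as there). The comparison principle
`tsum_sq_mul_enorm_mFourierCoeff_comp_le_of_increment_le` of that file (Faris–Simon's
`|∇ log(η+ε)|² = -∇η·∇(η+ε)⁻¹` in difference-quotient form) has a WEIGHTED twin needed for singular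
potentials: for `r ≥ 0` in `L²((ℝ/ℤ)^D)`, a multiplier `0 ≤ χ ≤ 1` that is Lipschitz along a coordinate `p`,
`ε > 0`, `ξ = χ²/(r+ε)` and `w = log(1 + r/ε)`, the weak `p`-derivative `H` of `w` obeys
`∫ χ²|H|² ≤ 4(4K² - 4π² re ∑ₙ nₚ² conj(r̂(n)) ξ̂(n))`. This file supplies its ingredients:

* `pointwise_weighted_log_ineq`: for `r₀, r₁ ≥ 0`, `0 ≤ χ₀ ≤ 1`, `0 ≤ χ₁`, `u = log(r₁+ε) - log(r₀+ε)`,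
  `¼χ₀²u² ≤ -(r₁-r₀)(χ₁²/(r₁+ε) - χ₀²/(r₀+ε)) + 4(χ₁-χ₀)² + |u|(χ₁-χ₀)² + ½|χ₁-χ₀|u²`
  (`-(A-B)(χ₁²/A - χ₀²/B) = χ₁²(e^{-u}-1) + χ₀²(e^{u}-1)`, `e^{±u} - 1 ∓ u ≥ 0`, `e^u + e^{-u} - 2 ≥ u²/2`);
  with `|χ₁ - χ₀| ≤ k` the error is `≤ k u² + 4k² + ½k³` (`pointwise_weighted_log_ineq_of_abs_sub_le`);
* `integral_weighted_increment_le`: its integral over the probability space at a shift `a` with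
  `|χ(·+a) - χ| ≤ k`: `¼ ∫ χ²|w(·+a) - w|² ≤ -re ∫ conj(g(·+a) - g)(ξ(·+a) - ξ) + k ∫|w(·+a) - w|² + (4k² + ½k³)`;
* `integral_conj_increment_mul_increment_eq`, `integral_norm_increment_sq_le`: Parseval for increments at the
  one-coordinate shift `a = s𝐞ₚ` (`hasSum_increment_conj_mul_increment`, `norm_mFourier_single_sub_one_sq`,
  `Torus.sq_mul_sinc_le`): `∫ conj(Δu)Δw = (2πs)² ∑ₙ (nₚ sinc(πnₚs))² conj(û(n)) ŵ(n)`,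
  `∫|Δw|² ≤ (2πs)² ∑ₙ nₚ²|ŵ(n)|²`; `quarter_inv_sq_mul_le`: the division of the resulting inequality by `s²`;
* `tendsto_lintegral_diffQuot_sub_sq`: **the difference quotients `(w(· + s𝐞ₚ) - w)/s` converge in `L²` to
  the weak derivative** `H` (`Ĥ(n) = 2πi nₚ ŵ(n)`) when `∑ₙ nₚ²|ŵ(n)|² < ∞` (Parseval, the coefficients
  `((eₙ(s𝐞ₚ)-1)/s - 2πi nₚ) ŵ(n)` are dominated by `16π² nₚ²|ŵ(n)|²` and tend to `0`
  (`tendsto_inv_mul_mFourier_single_sub_one`); Tannery's theorem);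
* `lintegral_mul_enorm_sq_le_of_tendsto`: Fatou along an a.e. convergent subsequence of an `L²`-convergent
  sequence, for weighted square integrals `∫ V |Fⱼ|²`.

## Mathlib / tree search

Mathlib: `tendsto_tsum_of_dominated_convergence` (Tannery), `tendstoInMeasure_of_tendsto_eLpNorm`,
`TendstoInMeasure.exists_seq_tendsto_ae`, `lintegral_liminf_le'` (Fatou), `hasDerivAt_iff_tendsto_slope_zero`,
`Real.norm_exp_I_mul_ofReal_sub_one_le`; no difference-quotient characterisation of `H¹` on `UnitAddTorus`.
Tree: `PeriodicMaxFormPositivity` (`memLp_increment`, `mFourierCoeff_increment`,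
`hasSum_increment_conj_mul_increment`, `norm_mFourier_single_sub_one_sq`), `TorusLipschitzFourierH1`
(`Torus.sq_mul_sinc_le`, `Torus.mFourier_single_coe`), `TorusSpectralWeakDerivative`
(`Torus.tsum_enorm_sq_mFourierCoeff`), `TorusSobolevNorm*` (`Torus.mFourierCoeff_add`, `Torus.mFourierCoeff_neg`,
`Torus.mFourierCoeff_const_smul`), `PeriodicMaxFormBound` (`memLp_piHaar_iff`).

## References

* W. Faris, B. Simon, *Degenerate and non-degenerate ground states for Schrödinger operators*, Duke Math.
  J. 42 (1975) 559–567, Thm. 1. [FarisSimon1975]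
* M. Reed, B. Simon, *Methods of Modern Mathematical Physics IV* (1978), §XIII.12, Thms XIII.44–XIII.48.
  [ReedSimonIV1978]
* D. Gilbarg, N. S. Trudinger, *Elliptic Partial Differential Equations of Second Order* (2001), Lemma 7.6,
  Thm. 7.8 (difference quotients and the chain rule in `W^{1,2}`). [GilbargTrudinger2001]
-/

noncomputable section

open MeasureTheory Filter UnitAddTorus
open scoped ENNReal NNReal Topology ComplexConjugate
open Literature.Analysis.FunctionSpaces

namespace Literature.MathematicalPhysics.QuantumManyBody.BoseGas

-- The measure on `ℝ/ℤ` is the Haar PROBABILITY measure, as in `PeriodicFormDomain.lean`.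
attribute [local instance] formDomain_measureSpace formDomain_isProbabilityMeasure formDomain_isProbabilityMeasure_pi

/-! ### The pointwise inequality -/

section Pointwise

/-- `e^u + e^{-u} - 2 ≥ u²/2`. [folklore] -/
theorem half_sq_le_exp_add_exp_neg_sub_two (u : ℝ) : u ^ 2 / 2 ≤ Real.exp u + Real.exp (-u) - 2 := by
  rcases le_total 0 u with hu | hu
  · have h1 : 1 + u + u ^ 2 / 2 ≤ Real.exp u := Real.quadratic_le_exp_of_nonneg hu
    have h2 : -u + 1 ≤ Real.exp (-u) := Real.add_one_le_exp (-u)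
    linarith
  · have hu' : 0 ≤ -u := by linarith
    have h1 : 1 + -u + (-u) ^ 2 / 2 ≤ Real.exp (-u) := Real.quadratic_le_exp_of_nonneg hu'
    have h2 : u + 1 ≤ Real.exp u := Real.add_one_le_exp u
    have h3 : (-u) ^ 2 = u ^ 2 := by ring
    linarith

/-- **The pointwise inequality behind the weighted log-gradient bound.** For `r₀, r₁ ≥ 0`, `ε > 0`,
`0 ≤ χ₀ ≤ 1`, `0 ≤ χ₁` and `u = log(r₁ + ε) - log(r₀ + ε)`:
`¼ χ₀² u² ≤ -(r₁ - r₀)(χ₁²/(r₁+ε) - χ₀²/(r₀+ε)) + 4(χ₁ - χ₀)² + |u|(χ₁ - χ₀)² + ½|χ₁ - χ₀| u²`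
(with `A = r₁ + ε`, `B = r₀ + ε`: `-(A-B)(χ₁²/A - χ₀²/B) = χ₁²(e^{-u} - 1) + χ₀²(e^{u} - 1)`, `e^{±u} - 1 ∓ u ≥ 0`,
`e^u + e^{-u} - 2 ≥ u²/2` with `m = min(χ₀, χ₁)`, and `2·m|u|·|d| ≤ ¼m²u² + 4d²`, `d = χ₁ - χ₀`). [folklore] -/
theorem pointwise_weighted_log_ineq {r₀ r₁ ε χ₀ χ₁ : ℝ} (hr₀ : 0 ≤ r₀) (hr₁ : 0 ≤ r₁) (hε : 0 < ε)
    (hχ₀ : 0 ≤ χ₀) (hχ₁ : 0 ≤ χ₁) (hχ₀1 : χ₀ ≤ 1) :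
    1 / 4 * χ₀ ^ 2 * (Real.log (r₁ + ε) - Real.log (r₀ + ε)) ^ 2 ≤
      -((r₁ - r₀) * (χ₁ ^ 2 / (r₁ + ε) - χ₀ ^ 2 / (r₀ + ε))) + 4 * (χ₁ - χ₀) ^ 2 +
        |Real.log (r₁ + ε) - Real.log (r₀ + ε)| * (χ₁ - χ₀) ^ 2 +
        1 / 2 * |χ₁ - χ₀| * (Real.log (r₁ + ε) - Real.log (r₀ + ε)) ^ 2 := by
  set A := r₁ + ε with hA
  set B := r₀ + ε with hB
  have hA0 : 0 < A := by rw [hA]; linarith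
  have hB0 : 0 < B := by rw [hB]; linarith
  set u := Real.log A - Real.log B with hu
  have heu : Real.exp u = A / B := by
    rw [hu, Real.exp_sub, Real.exp_log hA0, Real.exp_log hB0]
  have henu : Real.exp (-u) = B / A := by
    rw [Real.exp_neg, heu, inv_div]
  -- the algebraic identity
  have hid : -((r₁ - r₀) * (χ₁ ^ 2 / A - χ₀ ^ 2 / B)) =
      χ₁ ^ 2 * (Real.exp (-u) - 1) + χ₀ ^ 2 * (Real.exp u - 1) := by
    rw [heu, henu]
    have hr : r₁ - r₀ = A - B := by rw [hA, hB]; ring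
    rw [hr]
    field_simp
    ring
  -- lower bound of the main term
  set m := min χ₀ χ₁ with hm
  have hm0 : 0 ≤ m := le_min hχ₀ hχ₁
  have hmχ₀ : m ≤ χ₀ := min_le_left _ _
  have hmχ₁ : m ≤ χ₁ := min_le_right _ _
  have hφp : 0 ≤ Real.exp u - 1 - u := by linarith [Real.add_one_le_exp u]
  have hφn : 0 ≤ Real.exp (-u) - 1 + u := by linarith [Real.add_one_le_exp (-u)]
  have hcosh : u ^ 2 / 2 ≤ Real.exp u + Real.exp (-u) - 2 := half_sq_le_exp_add_exp_neg_sub_two u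
  have hmain : m ^ 2 * (u ^ 2 / 2) - |u| * |χ₀ ^ 2 - χ₁ ^ 2| ≤
      χ₁ ^ 2 * (Real.exp (-u) - 1) + χ₀ ^ 2 * (Real.exp u - 1) := by
    have h1 : χ₁ ^ 2 * (Real.exp (-u) - 1) + χ₀ ^ 2 * (Real.exp u - 1) =
        χ₁ ^ 2 * (Real.exp (-u) - 1 + u) + χ₀ ^ 2 * (Real.exp u - 1 - u) + u * (χ₀ ^ 2 - χ₁ ^ 2) := by ring
    have h2 : m ^ 2 * (Real.exp (-u) - 1 + u) ≤ χ₁ ^ 2 * (Real.exp (-u) - 1 + u) :=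
      mul_le_mul_of_nonneg_right (pow_le_pow_left₀ hm0 hmχ₁ 2) hφn
    have h3 : m ^ 2 * (Real.exp u - 1 - u) ≤ χ₀ ^ 2 * (Real.exp u - 1 - u) :=
      mul_le_mul_of_nonneg_right (pow_le_pow_left₀ hm0 hmχ₀ 2) hφp
    have h4 : -(|u| * |χ₀ ^ 2 - χ₁ ^ 2|) ≤ u * (χ₀ ^ 2 - χ₁ ^ 2) := by
      rw [← abs_mul]; exact neg_abs_le _
    have h5 : m ^ 2 * (u ^ 2 / 2) ≤ m ^ 2 * ((Real.exp (-u) - 1 + u) + (Real.exp u - 1 - u)) :=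
      mul_le_mul_of_nonneg_left (by linarith) (sq_nonneg _)
    nlinarith [h2, h3, h4, h5]
  -- the cross term
  set d := χ₁ - χ₀ with hd
  have hsq : |χ₀ ^ 2 - χ₁ ^ 2| ≤ |d| * (2 * m + |d|) := by
    have h1 : χ₀ ^ 2 - χ₁ ^ 2 = -(d * (χ₀ + χ₁)) := by rw [hd]; ring
    rw [h1, abs_neg, abs_mul]
    refine mul_le_mul_of_nonneg_left ?_ (abs_nonneg _)
    rw [abs_of_nonneg (by linarith)]
    rcases le_total χ₀ χ₁ with h | h
    · rw [hm, min_eq_left h, hd, abs_of_nonneg (by linarith)]; linarith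
    · rw [hm, min_eq_right h, hd, abs_of_nonpos (by linarith)]; linarith
  have hcross : |u| * |χ₀ ^ 2 - χ₁ ^ 2| ≤ m ^ 2 * u ^ 2 / 4 + 4 * d ^ 2 + |u| * d ^ 2 := by
    have h1 : |u| * |χ₀ ^ 2 - χ₁ ^ 2| ≤ |u| * (|d| * (2 * m + |d|)) :=
      mul_le_mul_of_nonneg_left hsq (abs_nonneg _)
    have h2 : |u| * (|d| * (2 * m + |d|)) = 2 * (m * |u|) * |d| + |u| * |d| ^ 2 := by ring
    have h3 : 2 * (m * |u|) * |d| ≤ m ^ 2 * u ^ 2 / 4 + 4 * d ^ 2 := by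
      nlinarith [sq_nonneg (m * |u| / 2 - 2 * |d|), sq_abs u, sq_abs d]
    rw [sq_abs] at h2
    linarith
  -- replace `m²` by `χ₀²`
  have hmχ : χ₀ ^ 2 ≤ m ^ 2 + 2 * |d| := by
    rcases le_total χ₀ χ₁ with h | h
    · rw [hm, min_eq_left h]; linarith [abs_nonneg d]
    · rw [hm, min_eq_right h, hd, abs_of_nonpos (by linarith)]
      nlinarith
  have hu2 : 0 ≤ u ^ 2 := sq_nonneg _
  have hfin : 1 / 4 * χ₀ ^ 2 * u ^ 2 ≤ 1 / 4 * m ^ 2 * u ^ 2 + 1 / 2 * |d| * u ^ 2 := by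
    have h1 := mul_le_mul_of_nonneg_right hmχ hu2
    have h2 : (m ^ 2 + 2 * |d|) * u ^ 2 = m ^ 2 * u ^ 2 + 2 * (|d| * u ^ 2) := by ring
    have h3 : 1 / 4 * m ^ 2 * u ^ 2 + 1 / 2 * |d| * u ^ 2 = 1 / 4 * (m ^ 2 * u ^ 2 + 2 * (|d| * u ^ 2)) := by ring
    have h4 : 1 / 4 * χ₀ ^ 2 * u ^ 2 = 1 / 4 * (χ₀ ^ 2 * u ^ 2) := by ring
    rw [h3, h4, ← h2]
    linarith
  rw [hid]
  linarith [hmain, hcross, hfin]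

/-- The pointwise inequality with the Lipschitz bound `|χ₁ - χ₀| ≤ k` inserted:
`¼ χ₀² u² ≤ -(r₁ - r₀)(χ₁²/(r₁+ε) - χ₀²/(r₀+ε)) + k u² + (4k² + ½k³)`
(`|u| k² ≤ ½ k u² + ½ k³`). [folklore] -/
theorem pointwise_weighted_log_ineq_of_abs_sub_le {r₀ r₁ ε χ₀ χ₁ k : ℝ} (hr₀ : 0 ≤ r₀) (hr₁ : 0 ≤ r₁)
    (hε : 0 < ε) (hχ₀ : 0 ≤ χ₀) (hχ₁ : 0 ≤ χ₁) (hχ₀1 : χ₀ ≤ 1) (hk : |χ₁ - χ₀| ≤ k) :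
    1 / 4 * χ₀ ^ 2 * (Real.log (r₁ + ε) - Real.log (r₀ + ε)) ^ 2 ≤
      -((r₁ - r₀) * (χ₁ ^ 2 / (r₁ + ε) - χ₀ ^ 2 / (r₀ + ε))) +
        k * (Real.log (r₁ + ε) - Real.log (r₀ + ε)) ^ 2 + (4 * k ^ 2 + 1 / 2 * k ^ 3) := by
  have h := pointwise_weighted_log_ineq hr₀ hr₁ hε hχ₀ hχ₁ hχ₀1
  set u := Real.log (r₁ + ε) - Real.log (r₀ + ε) with hu
  set d := χ₁ - χ₀ with hd
  have hd0 : 0 ≤ |d| := abs_nonneg _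
  have hk0 : 0 ≤ k := hd0.trans hk
  have h1 : d ^ 2 ≤ k ^ 2 := by
    rw [← sq_abs]; exact pow_le_pow_left₀ hd0 hk 2
  have h2 : |u| * d ^ 2 ≤ 1 / 2 * k * u ^ 2 + 1 / 2 * k ^ 3 := by
    have h3 : |u| * |d| ≤ (u ^ 2 + d ^ 2) / 2 := by
      nlinarith [sq_nonneg (|u| - |d|), sq_abs u, sq_abs d]
    calc |u| * d ^ 2 = (|u| * |d|) * |d| := by rw [← sq_abs]; ring
      _ ≤ (u ^ 2 + d ^ 2) / 2 * k := mul_le_mul h3 hk hd0 (by positivity)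
      _ ≤ _ := by nlinarith [h1, hk0, sq_nonneg u]
  have h3 : 1 / 2 * |d| * u ^ 2 ≤ 1 / 2 * k * u ^ 2 := by
    have := mul_le_mul_of_nonneg_right hk (sq_nonneg u)
    linarith
  linarith

/-- `log(1 + b/ε) - log(1 + a/ε) = log(b + ε) - log(a + ε)` for `a, b ≥ 0`, `ε > 0`. [folklore] -/
theorem log_one_add_div_sub_log_one_add_div {a b ε : ℝ} (ha : 0 ≤ a) (hb : 0 ≤ b) (hε : 0 < ε) :
    Real.log (1 + b / ε) - Real.log (1 + a / ε) = Real.log (b + ε) - Real.log (a + ε) := by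
  have h : ∀ x : ℝ, 0 ≤ x → Real.log (1 + x / ε) = Real.log (x + ε) - Real.log ε := fun x hx => by
    rw [← Real.log_div (by positivity) hε.ne']
    congr 1
    field_simp
    ring
  rw [h b hb, h a ha]
  ring

end Pointwise

/-! ### Real bookkeeping -/

section Arithmetic

/-- The real kinetic sequence `nₚ² |c(n)|²` is summable when its `ℝ≥0∞` sum is finite. [folklore] -/
theorem summable_sq_mul_norm_sq_of_tsum_ne_top {D : Type*} (p : D) {c : (D → ℤ) → ℂ}
    (hc : ∑' n : D → ℤ, ENNReal.ofReal ((n p : ℝ) ^ 2) * ‖c n‖ₑ ^ 2 ≠ ⊤) :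
    Summable fun n : D → ℤ => (n p : ℝ) ^ 2 * ‖c n‖ ^ 2 := by
  have hterm : ∀ n : D → ℤ, ENNReal.ofReal ((n p : ℝ) ^ 2) * ‖c n‖ₑ ^ 2 =
      ENNReal.ofReal ((n p : ℝ) ^ 2 * ‖c n‖ ^ 2) := fun n => by
    rw [← ofReal_norm, ← ENNReal.ofReal_pow (norm_nonneg _), ← ENNReal.ofReal_mul (sq_nonneg _)]
  simp only [hterm] at hc
  simpa only [ENNReal.toReal_ofReal (mul_nonneg (sq_nonneg _) (sq_nonneg _))] using ENNReal.summable_toReal hc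

/-- Division of the integrated increment inequality by `s²`: from
`¼ I₁ ≤ -Y + K|s| I₂ + (4(K|s|)² + ½(K|s|)³)`, `Y = (2πs)² X`, `I₂ ≤ (2πs)² K_w` one gets
`¼ s⁻² I₁ ≤ 4K² - 4π² X + |s| (4π² K K_w + ½ K³)`. [folklore] -/
theorem quarter_inv_sq_mul_le {I₁ I₂ Y X Kw K s : ℝ} (hK : 0 ≤ K) (hs : s ≠ 0)
    (hP : 1 / 4 * I₁ ≤ -Y + K * |s| * I₂ + (4 * (K * |s|) ^ 2 + 1 / 2 * (K * |s|) ^ 3))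
    (hY : Y = (2 * Real.pi * s) ^ 2 * X) (hI₂ : I₂ ≤ (2 * Real.pi * s) ^ 2 * Kw) :
    1 / 4 * ((s ^ 2)⁻¹ * I₁) ≤
      4 * K ^ 2 - 4 * Real.pi ^ 2 * X + |s| * (4 * Real.pi ^ 2 * K * Kw + 1 / 2 * K ^ 3) := by
  have hA : 0 < |s| := abs_pos.2 hs
  have hs2 : (2 * Real.pi * s) ^ 2 = 4 * Real.pi ^ 2 * |s| ^ 2 := by
    rw [sq_abs]; ring
  rw [hY, hs2] at hP
  rw [hs2] at hI₂
  have h1 : K * |s| * I₂ ≤ K * |s| * (4 * Real.pi ^ 2 * |s| ^ 2 * Kw) :=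
    mul_le_mul_of_nonneg_left hI₂ (mul_nonneg hK hA.le)
  rw [← sq_abs s, show 1 / 4 * ((|s| ^ 2)⁻¹ * I₁) = (|s| ^ 2)⁻¹ * (1 / 4 * I₁) by ring,
    inv_mul_le_iff₀ (pow_pos hA 2)]
  nlinarith [hP, h1]

end Arithmetic

/-! ### Increments at one-coordinate shifts -/

section Increment

variable {D : Type*} [Fintype D]

/-- `χ² |f|²` is integrable for `f ∈ L²` and a measurable multiplier `χ` with values in `[0, 1]`. [folklore] -/
theorem integrable_sq_mul_norm_sq {α : Type*} [MeasurableSpace α] {μ : Measure α} {χ : α → ℝ}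
    (hχ : Measurable χ) (hχ0 : ∀ t, 0 ≤ χ t) (hχ1 : ∀ t, χ t ≤ 1) {f : α → ℂ} (hf : MemLp f 2 μ) :
    Integrable (fun t => χ t ^ 2 * ‖f t‖ ^ 2) μ := by
  have hI2 : Integrable (fun t => ‖f t‖ ^ 2) μ := hf.integrable_norm_pow two_ne_zero
  refine hI2.mono' (((hχ.pow_const 2).aemeasurable.mul hI2.aemeasurable).aestronglyMeasurable)
    (Eventually.of_forall fun t => ?_)
  rw [Real.norm_of_nonneg (by positivity)]
  have h1 : χ t ^ 2 ≤ 1 := pow_le_one₀ (hχ0 t) (hχ1 t)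
  calc χ t ^ 2 * ‖f t‖ ^ 2 ≤ 1 * ‖f t‖ ^ 2 := mul_le_mul_of_nonneg_right h1 (sq_nonneg _)
    _ = ‖f t‖ ^ 2 := one_mul _

/-- **The weighted increment inequality at a fixed shift.** With `g = r`, `ξ = χ²/(r+ε)`, `w = log(1 + r/ε)`
(`r ≥ 0` in `L²`, `0 ≤ χ ≤ 1` measurable, `|χ(t+a) - χ(t)| ≤ k`):
`¼ ∫ χ² |w(·+a) - w|² ≤ -re ∫ conj(g(·+a) - g)(ξ(·+a) - ξ) + k ∫ |w(·+a) - w|² + (4k² + ½k³)`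
(integrate `pointwise_weighted_log_ineq_of_abs_sub_le` over the probability space). [folklore] -/
theorem integral_weighted_increment_le {r χ : UnitAddTorus D → ℝ} (hχ : Measurable χ) (hr0 : ∀ t, 0 ≤ r t)
    (hχ0 : ∀ t, 0 ≤ χ t) (hχ1 : ∀ t, χ t ≤ 1) {ε : ℝ} (hε : 0 < ε) {g ξ w : UnitAddTorus D → ℂ}
    (hgd : g = fun t => ((r t : ℝ) : ℂ)) (hξd : ξ = fun t => ((χ t ^ 2 / (r t + ε) : ℝ) : ℂ))
    (hwd : w = fun t => ((Real.log (1 + r t / ε) : ℝ) : ℂ)) (hg : MemLp g 2 volume) (hξm : MemLp ξ 2 volume)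
    (hwm : MemLp w 2 volume) (a : UnitAddTorus D) {k : ℝ} (hk : ∀ t, |χ (t + a) - χ t| ≤ k) :
    1 / 4 * ∫ t, χ t ^ 2 * ‖w (t + a) - w t‖ ^ 2 ≤
      -(∫ t, conj (g (t + a) - g t) * (ξ (t + a) - ξ t)).re + k * (∫ t, ‖w (t + a) - w t‖ ^ 2) +
        (4 * k ^ 2 + 1 / 2 * k ^ 3) := by
  -- integrability
  have hI2 : Integrable (fun t => ‖w (t + a) - w t‖ ^ 2) volume :=
    (memLp_increment hwm a).integrable_norm_pow two_ne_zero
  have hI1 : Integrable (fun t => χ t ^ 2 * ‖w (t + a) - w t‖ ^ 2) volume :=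
    integrable_sq_mul_norm_sq hχ hχ0 hχ1 (memLp_increment hwm a)
  have hprod : Integrable (fun t => conj (g (t + a) - g t) * (ξ (t + a) - ξ t)) volume := by
    have h := (memLp_increment hg a).star.integrable_mul (memLp_increment hξm a)
    refine h.congr (Eventually.of_forall fun t => ?_)
    simp only [Pi.mul_apply, Pi.star_apply, Complex.star_def]
  have hre := hprod.re
  have hreint : ∫ t, (conj (g (t + a) - g t) * (ξ (t + a) - ξ t)).re =
      (∫ t, conj (g (t + a) - g t) * (ξ (t + a) - ξ t)).re := by
    have h := integral_re hprod
    simpa only [RCLike.re_to_complex] using h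
  simp only [RCLike.re_to_complex] at hre
  -- the pointwise inequality
  have hpt : ∀ t, 1 / 4 * (χ t ^ 2 * ‖w (t + a) - w t‖ ^ 2) ≤
      -(conj (g (t + a) - g t) * (ξ (t + a) - ξ t)).re + k * ‖w (t + a) - w t‖ ^ 2 +
        (4 * k ^ 2 + 1 / 2 * k ^ 3) := by
    intro t
    have hu : ‖w (t + a) - w t‖ ^ 2 = (Real.log (r (t + a) + ε) - Real.log (r t + ε)) ^ 2 := by
      rw [hwd, ← Complex.ofReal_sub, Complex.norm_real, Real.norm_eq_abs, sq_abs,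
        log_one_add_div_sub_log_one_add_div (hr0 t) (hr0 (t + a)) hε]
    have hre' : (conj (g (t + a) - g t) * (ξ (t + a) - ξ t)).re =
        (r (t + a) - r t) * (χ (t + a) ^ 2 / (r (t + a) + ε) - χ t ^ 2 / (r t + ε)) := by
      rw [hgd, hξd, ← Complex.ofReal_sub, ← Complex.ofReal_sub, Complex.conj_ofReal, ← Complex.ofReal_mul,
        Complex.ofReal_re]
    rw [hu, hre']
    have h := pointwise_weighted_log_ineq_of_abs_sub_le (hr0 t) (hr0 (t + a)) hε (hχ0 t) (hχ0 (t + a))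
      (hχ1 t) (hk t)
    linarith
  -- integrate
  have hA : Integrable (fun t => -(conj (g (t + a) - g t) * (ξ (t + a) - ξ t)).re) volume := hre.neg
  have hB : Integrable (fun t => k * ‖w (t + a) - w t‖ ^ 2) volume := hI2.const_mul k
  have hAB : Integrable (fun t => -(conj (g (t + a) - g t) * (ξ (t + a) - ξ t)).re +
      k * ‖w (t + a) - w t‖ ^ 2) volume := hA.add hB
  have hR : Integrable (fun t => -(conj (g (t + a) - g t) * (ξ (t + a) - ξ t)).re +
      k * ‖w (t + a) - w t‖ ^ 2 + (4 * k ^ 2 + 1 / 2 * k ^ 3)) volume := hAB.add (integrable_const _)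
  calc 1 / 4 * ∫ t, χ t ^ 2 * ‖w (t + a) - w t‖ ^ 2
      = ∫ t, 1 / 4 * (χ t ^ 2 * ‖w (t + a) - w t‖ ^ 2) := (integral_const_mul _ _).symm
    _ ≤ ∫ t, (-(conj (g (t + a) - g t) * (ξ (t + a) - ξ t)).re + k * ‖w (t + a) - w t‖ ^ 2 +
          (4 * k ^ 2 + 1 / 2 * k ^ 3)) := integral_mono (hI1.const_mul _) hR hpt
    _ = _ := by
      rw [integral_add hAB (integrable_const _), integral_add hA hB, integral_neg, integral_const_mul,
        integral_const, hreint]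
      simp

variable [DecidableEq D]

/-- **Parseval for a pair of increments at a one-coordinate shift**: for `u, w ∈ L²((ℝ/ℤ)^D)`,
`∫ conj(u(t+s𝐞ₚ) - u(t)) (w(t+s𝐞ₚ) - w(t)) dt = (2πs)² ∑ₙ (nₚ sinc(π nₚ s))² conj(û(n)) ŵ(n)`. [folklore] -/
theorem integral_conj_increment_mul_increment_eq {u w : UnitAddTorus D → ℂ} (hu : MemLp u 2 volume)
    (hw : MemLp w 2 volume) (p : D) (s : ℝ) :
    ∫ t, conj (u (t + Pi.single p ((s : ℝ) : UnitAddCircle)) - u t) *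
        (w (t + Pi.single p ((s : ℝ) : UnitAddCircle)) - w t) =
      (((2 * Real.pi * s) ^ 2 : ℝ) : ℂ) * ∑' n : D → ℤ, ((((n p : ℝ) * Real.sinc (Real.pi * (n p) * s)) ^ 2 : ℝ) : ℂ) *
        (conj (mFourierCoeff u n) * mFourierCoeff w n) := by
  rw [← (hasSum_increment_conj_mul_increment hu hw (Pi.single p ((s : ℝ) : UnitAddCircle))).tsum_eq,
    ← tsum_mul_left]
  refine tsum_congr fun n => ?_
  rw [norm_mFourier_single_sub_one_sq]
  push_cast
  ring

/-- **The `L²` increment bound** `∫ |w(t+s𝐞ₚ) - w(t)|² dt ≤ (2πs)² ∑ₙ nₚ² |ŵ(n)|²` for `w ∈ L²` of finite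
`p`-energy (Parseval for increments and `(nₚ sinc(π nₚ s))² ≤ nₚ²`). [folklore] -/
theorem integral_norm_increment_sq_le {w : UnitAddTorus D → ℂ} (hw : MemLp w 2 volume) (p : D)
    (hkin : Summable fun n : D → ℤ => (n p : ℝ) ^ 2 * ‖mFourierCoeff w n‖ ^ 2) (s : ℝ) :
    ∫ t, ‖w (t + Pi.single p ((s : ℝ) : UnitAddCircle)) - w t‖ ^ 2 ≤
      (2 * Real.pi * s) ^ 2 * ∑' n : D → ℤ, (n p : ℝ) ^ 2 * ‖mFourierCoeff w n‖ ^ 2 := by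
  set a : UnitAddTorus D := Pi.single p ((s : ℝ) : UnitAddCircle) with ha
  have h := Complex.hasSum_re (hasSum_increment_conj_mul_increment hw hw a)
  have hprod : Integrable (fun t => conj (w (t + a) - w t) * (w (t + a) - w t)) volume := by
    have h := (memLp_increment hw a).star.integrable_mul (memLp_increment hw a)
    refine h.congr (Eventually.of_forall fun t => ?_)
    simp only [Pi.mul_apply, Pi.star_apply, Complex.star_def]
  have hval : (∫ t, conj (w (t + a) - w t) * (w (t + a) - w t)).re = ∫ t, ‖w (t + a) - w t‖ ^ 2 := by
    have h1 := integral_re hprod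
    simp only [RCLike.re_to_complex] at h1
    rw [← h1]
    refine integral_congr_ae (Eventually.of_forall fun t => ?_)
    dsimp only
    rw [Complex.conj_mul', ← Complex.ofReal_pow, Complex.ofReal_re]
  rw [hval] at h
  refine hasSum_le (fun n => ?_) h (hkin.hasSum.mul_left ((2 * Real.pi * s) ^ 2))
  rw [Complex.conj_mul', ← Complex.ofReal_pow, ← Complex.ofReal_mul, Complex.ofReal_re, ha,
    norm_mFourier_single_sub_one_sq, mul_assoc]
  refine mul_le_mul_of_nonneg_left ?_ (sq_nonneg _)
  exact mul_le_mul_of_nonneg_right (Torus.sq_mul_sinc_le _ _) (sq_nonneg _)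


/-! ### Difference quotients and the weak derivative -/

/-- `(e_n(s𝐞ₚ) - 1)/s → 2πi nₚ` along any real sequence `sⱼ → 0`, `sⱼ ≠ 0` (the derivative of
`s ↦ e^{2πi nₚ s}` at `0`). [folklore] -/
theorem tendsto_inv_mul_mFourier_single_sub_one (n : D → ℤ) (p : D) {s : ℕ → ℝ} (hs0 : ∀ j, s j ≠ 0)
    (hslim : Tendsto s atTop (𝓝 0)) :
    Tendsto (fun j => (((s j)⁻¹ : ℝ) : ℂ) *
      (mFourier n (Pi.single p ((s j : ℝ) : UnitAddCircle) : UnitAddTorus D) - 1))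
      atTop (𝓝 (2 * Real.pi * Complex.I * (n p))) := by
  set c : ℂ := 2 * Real.pi * Complex.I * (n p) with hc
  have hφ : ∀ x : ℝ, mFourier n (Pi.single p ((x : ℝ) : UnitAddCircle) : UnitAddTorus D) =
      Complex.exp (c * x) := by
    intro x
    rw [Torus.mFourier_single_coe]
    congr 1
    push_cast
    ring
  have hderiv : HasDerivAt (fun x : ℝ => Complex.exp (c * x)) c 0 := by
    have h1 : HasDerivAt (fun y : ℂ => Complex.exp (c * y)) (Complex.exp (c * ((0 : ℝ) : ℂ)) * (c * 1))
        ((0 : ℝ) : ℂ) := ((hasDerivAt_id' ((0 : ℝ) : ℂ)).const_mul c).cexp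
    have h2 : Complex.exp (c * ((0 : ℝ) : ℂ)) * (c * 1) = c := by simp
    rw [h2] at h1
    exact h1.comp_ofReal
  rw [hasDerivAt_iff_tendsto_slope_zero] at hderiv
  have hten : Tendsto s atTop (𝓝[≠] 0) :=
    tendsto_nhdsWithin_iff.2 ⟨hslim, Eventually.of_forall fun j => hs0 j⟩
  have h := hderiv.comp hten
  refine (tendsto_congr fun j => ?_).1 h
  simp only [Function.comp_apply, zero_add, hφ, Complex.ofReal_zero, mul_zero, Complex.exp_zero,
    Complex.real_smul, Complex.ofReal_inv]

/-- **The difference quotients of `w` along `p` converge in `L²` to the weak derivative**: if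
`w, H ∈ L²((ℝ/ℤ)^D)`, `∑ₙ nₚ²|ŵ(n)|² < ∞` and `Ĥ(n) = 2πi nₚ ŵ(n)`, then
`∫ |(w(t + sⱼ𝐞ₚ) - w(t))/sⱼ - H(t)|² dt → 0` along any `sⱼ → 0`, `sⱼ ≠ 0` (Parseval:
the coefficients are `((e_n(sⱼ𝐞ₚ) - 1)/sⱼ - 2πi nₚ) ŵ(n)`, dominated by `16π² nₚ² |ŵ(n)|²`; Tannery).
[folklore] -/
theorem tendsto_lintegral_diffQuot_sub_sq {w H : UnitAddTorus D → ℂ} (hw : MemLp w 2 volume)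
    (hH : MemLp H 2 volume) (p : D) (hkin : Summable fun n : D → ℤ => (n p : ℝ) ^ 2 * ‖mFourierCoeff w n‖ ^ 2)
    (hcoef : ∀ n : D → ℤ, mFourierCoeff H n = (2 * Real.pi * Complex.I * (n p)) * mFourierCoeff w n)
    {s : ℕ → ℝ} (hs0 : ∀ j, s j ≠ 0) (hslim : Tendsto s atTop (𝓝 0)) :
    Tendsto (fun j => ∫⁻ t, ‖(((s j)⁻¹ : ℝ) : ℂ) *
        (w (t + Pi.single p ((s j : ℝ) : UnitAddCircle)) - w t) - H t‖ₑ ^ 2) atTop (𝓝 0) := by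
  -- notation: shifts, coefficient multipliers, the `L²` functions
  set a : ℕ → UnitAddTorus D := fun j => Pi.single p ((s j : ℝ) : UnitAddCircle) with ha
  set c : ℕ → (D → ℤ) → ℂ := fun j n =>
    (((s j)⁻¹ : ℝ) : ℂ) * (mFourier n (a j) - 1) - 2 * Real.pi * Complex.I * (n p) with hc
  set G : ℕ → UnitAddTorus D → ℂ := fun j => ((((s j)⁻¹ : ℝ) : ℂ) • fun t => w (t + a j) - w t) + -H with hG
  have hGm : ∀ j, MemLp (G j) 2 volume := fun j => ((memLp_increment hw (a j)).const_smul _).add hH.neg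
  -- Fourier coefficients of `G j`
  have hcoefG : ∀ j n, mFourierCoeff (G j) n = c j n * mFourierCoeff w n := by
    intro j n
    have hi1 := (memLp_piHaar_iff.1 (memLp_piHaar_of_memLp
      ((memLp_increment hw (a j)).const_smul (((s j)⁻¹ : ℝ) : ℂ)))).integrable one_le_two
    have hi2 := (memLp_piHaar_iff.1 (memLp_piHaar_of_memLp hH.neg)).integrable one_le_two
    rw [hG]
    dsimp only
    rw [Torus.mFourierCoeff_add hi1 hi2 n, Torus.mFourierCoeff_const_smul, Torus.mFourierCoeff_neg,
      mFourierCoeff_increment hw (a j) n, hcoef n, smul_eq_mul, hc]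
    ring
  -- Parseval for `G j`
  have hpars : ∀ j, ∫⁻ t, ‖(((s j)⁻¹ : ℝ) : ℂ) * (w (t + Pi.single p ((s j : ℝ) : UnitAddCircle)) - w t) - H t‖ₑ ^ 2 =
      ∑' n : D → ℤ, ‖c j n * mFourierCoeff w n‖ₑ ^ 2 := by
    intro j
    have h := Torus.tsum_enorm_sq_mFourierCoeff (memLp_piHaar_iff.1 (memLp_piHaar_of_memLp (hGm j)))
    rw [Torus.volume_eq_pi_haarAddCircle] at h
    simp only [hcoefG] at h
    rw [h]
    refine lintegral_congr fun t => ?_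
    simp only [hG, ha, Pi.add_apply, Pi.neg_apply, Pi.smul_apply, smul_eq_mul, sub_eq_add_neg]
  simp only [hpars]
  -- the real form of the sums
  have hb0 : ∀ j n, 0 ≤ ‖c j n * mFourierCoeff w n‖ ^ 2 := fun j n => sq_nonneg _
  have hcb : ∀ j n, ‖c j n‖ ≤ 4 * Real.pi * |(n p : ℝ)| := by
    intro j n
    have h1 : ‖mFourier n (a j) - 1‖ ≤ |2 * Real.pi * (n p) * s j| := by
      rw [ha]
      dsimp only
      rw [Torus.mFourier_single_coe]
      exact Real.norm_exp_I_mul_ofReal_sub_one_le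
    have h2 : ‖(((s j)⁻¹ : ℝ) : ℂ) * (mFourier n (a j) - 1)‖ ≤ 2 * Real.pi * |(n p : ℝ)| := by
      rw [norm_mul, Complex.norm_real, Real.norm_eq_abs, abs_inv]
      calc |s j|⁻¹ * ‖mFourier n (a j) - 1‖ ≤ |s j|⁻¹ * |2 * Real.pi * (n p) * s j| :=
            mul_le_mul_of_nonneg_left h1 (inv_nonneg.2 (abs_nonneg _))
        _ = 2 * Real.pi * |(n p : ℝ)| := by
            rw [abs_mul, abs_mul, abs_mul, abs_of_pos Real.pi_pos, abs_two]
            field_simp [abs_ne_zero.2 (hs0 j)]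
    have h3 : ‖(2 * Real.pi * Complex.I * (n p) : ℂ)‖ = 2 * Real.pi * |(n p : ℝ)| := by
      simp only [norm_mul, Complex.norm_ofNat, Complex.norm_real, Real.norm_eq_abs, Complex.norm_I, mul_one,
        Complex.norm_intCast, abs_of_pos Real.pi_pos]
    calc ‖c j n‖ ≤ ‖(((s j)⁻¹ : ℝ) : ℂ) * (mFourier n (a j) - 1)‖ + ‖(2 * Real.pi * Complex.I * (n p) : ℂ)‖ :=
          norm_sub_le _ _
      _ ≤ 2 * Real.pi * |(n p : ℝ)| + 2 * Real.pi * |(n p : ℝ)| := add_le_add h2 h3.le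
      _ = 4 * Real.pi * |(n p : ℝ)| := by ring
  have hdom : ∀ j n, ‖‖c j n * mFourierCoeff w n‖ ^ 2‖ ≤ 16 * Real.pi ^ 2 * ((n p : ℝ) ^ 2 * ‖mFourierCoeff w n‖ ^ 2) := by
    intro j n
    rw [Real.norm_of_nonneg (sq_nonneg _), norm_mul, mul_pow]
    have h := hcb j n
    have h0 : 0 ≤ ‖c j n‖ := norm_nonneg _
    calc ‖c j n‖ ^ 2 * ‖mFourierCoeff w n‖ ^ 2 ≤ (4 * Real.pi * |(n p : ℝ)|) ^ 2 * ‖mFourierCoeff w n‖ ^ 2 :=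
          mul_le_mul_of_nonneg_right (pow_le_pow_left₀ h0 h 2) (sq_nonneg _)
      _ = 16 * Real.pi ^ 2 * ((n p : ℝ) ^ 2 * ‖mFourierCoeff w n‖ ^ 2) := by rw [mul_pow, mul_pow, sq_abs]; ring
  have hsb : ∀ j, Summable fun n : D → ℤ => ‖c j n * mFourierCoeff w n‖ ^ 2 := fun j =>
    Summable.of_norm_bounded (hkin.mul_left (16 * Real.pi ^ 2)) (hdom j)
  have hofReal : ∀ j, ∑' n : D → ℤ, ‖c j n * mFourierCoeff w n‖ₑ ^ 2 =
      ENNReal.ofReal (∑' n : D → ℤ, ‖c j n * mFourierCoeff w n‖ ^ 2) := by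
    intro j
    rw [ENNReal.ofReal_tsum_of_nonneg (hb0 j) (hsb j)]
    refine tsum_congr fun n => ?_
    rw [← ofReal_norm, ← ENNReal.ofReal_pow (norm_nonneg _)]
  simp only [hofReal]
  rw [← ENNReal.ofReal_zero]
  refine ENNReal.tendsto_ofReal ?_
  -- Tannery
  have hlim : ∀ n : D → ℤ, Tendsto (fun j => ‖c j n * mFourierCoeff w n‖ ^ 2) atTop (𝓝 0) := by
    intro n
    have h1 : Tendsto (fun j => c j n) atTop (𝓝 0) := by
      have h := (tendsto_inv_mul_mFourier_single_sub_one n p hs0 hslim).sub_const (2 * Real.pi * Complex.I * (n p))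
      rw [sub_self] at h
      exact h
    have h2 := ((h1.mul_const (mFourierCoeff w n)).norm).pow 2
    rw [zero_mul, norm_zero, zero_pow two_ne_zero] at h2
    exact h2
  have h := tendsto_tsum_of_dominated_convergence (hkin.mul_left (16 * Real.pi ^ 2)) hlim
    (Eventually.of_forall fun j n => hdom j n)
  rwa [tsum_zero] at h

omit [DecidableEq D] in
/-- **Fatou along an a.e.-convergent subsequence**: if `Fⱼ → H` in `L²(μ)` (`∫ |Fⱼ - H|² → 0`) and
`∫ V |Fⱼ|² ≤ bⱼ` with `bⱼ → B`, then `∫ V |H|² ≤ B`, for a finite measurable weight `V`. [folklore] -/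
theorem lintegral_mul_enorm_sq_le_of_tendsto {α : Type*} [MeasurableSpace α] {μ : Measure α}
    {F : ℕ → α → ℂ} {H : α → ℂ} {V : α → ℝ≥0∞} (hV : Measurable V) (hVtop : ∀ t, V t ≠ ∞)
    (hF : ∀ j, AEStronglyMeasurable (F j) μ) (hH : AEStronglyMeasurable H μ)
    (hlim : Tendsto (fun j => ∫⁻ t, ‖F j t - H t‖ₑ ^ 2 ∂μ) atTop (𝓝 0)) {b : ℕ → ℝ≥0∞} {B : ℝ≥0∞}
    (hb : Tendsto b atTop (𝓝 B)) (hle : ∀ j, ∫⁻ t, V t * ‖F j t‖ₑ ^ 2 ∂μ ≤ b j) :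
    ∫⁻ t, V t * ‖H t‖ₑ ^ 2 ∂μ ≤ B := by
  -- `L²` convergence, convergence in measure, an a.e. convergent subsequence
  have h2 : Tendsto (fun j => eLpNorm (F j - H) 2 μ) atTop (𝓝 0) := by
    have h := ((ENNReal.continuous_rpow_const (y := (1 / 2 : ℝ))).tendsto 0).comp hlim
    rw [ENNReal.zero_rpow_of_pos (by norm_num)] at h
    refine (tendsto_congr fun j => ?_).2 h
    rw [Function.comp_apply, eLpNorm_eq_lintegral_rpow_enorm_toReal two_ne_zero ENNReal.ofNat_ne_top,
      ENNReal.toReal_ofNat]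
    simp only [Pi.sub_apply, ENNReal.rpow_two]
  have hmeas : TendstoInMeasure μ F atTop H := tendstoInMeasure_of_tendsto_eLpNorm two_ne_zero hF hH h2
  obtain ⟨ns, hns, hae⟩ := hmeas.exists_seq_tendsto_ae
  have hptw : ∀ᵐ t ∂μ, Tendsto (fun i => V t * ‖F (ns i) t‖ₑ ^ 2) atTop (𝓝 (V t * ‖H t‖ₑ ^ 2)) :=
    hae.mono fun t ht => ENNReal.Tendsto.const_mul (((ENNReal.continuous_pow 2).tendsto _).comp ht.enorm)
      (Or.inr (hVtop t))
  calc ∫⁻ t, V t * ‖H t‖ₑ ^ 2 ∂μ = ∫⁻ t, liminf (fun i => V t * ‖F (ns i) t‖ₑ ^ 2) atTop ∂μ :=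
        lintegral_congr_ae (hptw.mono fun t ht => ht.liminf_eq.symm)
    _ ≤ liminf (fun i => ∫⁻ t, V t * ‖F (ns i) t‖ₑ ^ 2 ∂μ) atTop :=
        lintegral_liminf_le' fun i => hV.aemeasurable.mul ((hF (ns i)).enorm.pow_const 2)
    _ ≤ liminf (fun i => b (ns i)) atTop := liminf_le_liminf (Eventually.of_forall fun i => hle (ns i))
    _ = B := (hb.comp hns.tendsto_atTop).liminf_eq

end Increment

end Literature.MathematicalPhysics.QuantumManyBody.BoseGas

end
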